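import Summits.AtomisticToContinuum.Crystallization.Theorems.ChargedEnergyGapDominoLedgerK
import HarnessLib

/-!
# BoxForms (lens-3 g90, NODE 104) — closed-form bounds of linear and quadratic forms on a symmetric box `|δ i| ≤ h i`

Third cost-side piece.  A census cell is a symmetric box around its centre `z₀` in the chart coordinates, `δ = z − z₀`, `|δ i| ≤ h i`.  Every
«for all δ in the cell» side condition of the replay (NODE 102's `|a| ≤ amax`, `|b| ≤ bmax`; the region rows and the final affine comparison of
cost and cap) is an affine or quadratic form in `δ`, and on a symmetric box its extremum has a CLOSED RATIONAL FORM — no corner enumeration: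
* `linear_abs_le_absBox   : (∀ i, |δ i| ≤ h i) → |∑ i, A i * δ i| ≤ ∑ i, |A i| * h i`                      (gives `bmax` for `b = ∇Q(z₀)·δ`);
* `affine_ge_on_absBox    : (∀ i, |δ i| ≤ h i) → A₀ - ∑ i, |A i| * h i ≤ A₀ + ∑ i, A i * δ i`             (an affine row holds on the cell iff ONE rational check);
* `affine_nonneg_on_absBox: (∀ i, |δ i| ≤ h i) → ∑ i, |A i| * h i ≤ A₀ → 0 ≤ A₀ + ∑ i, A i * δ i`;
* `quad_abs_le_absBox     : (∀ i, |δ i| ≤ h i) → |∑ i, ∑ j, H i j * δ i * δ j| ≤ ∑ i, ∑ j, |H i j| * h i * h j`  (gives `amax` for `a = δᵀ(½∇²Q)δ`).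
Pure algebra over `Fin n → ℝ` (any `Fintype` index); imports the lane's DominoLedgerK only to sit in the lane's build cone.
-/

noncomputable section
open scoped Classical
open Finset

namespace Summit.AtomisticToContinuum.Crystallization.Theorems.ChargedEnergyGapChartDial

variable {ι : Type*} [Fintype ι]

/-- `|∑ A i δ i| ≤ ∑ |A i| h i` on the box `|δ i| ≤ h i`. -/
theorem linear_abs_le_absBox (A h δ : ι → ℝ) (hδ : ∀ i, |δ i| ≤ h i) :
    |∑ i, A i * δ i| ≤ ∑ i, |A i| * h i := by
  refine (abs_sum_le_sum_abs _ _).trans (sum_le_sum fun i _ => ?_)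
  rw [abs_mul]
  exact mul_le_mul_of_nonneg_left (hδ i) (abs_nonneg _)

/-- The minimum of an affine function over the box in closed form: `A₀ − ∑ |A i| h i ≤ A₀ + ∑ A i δ i`. -/
theorem affine_ge_on_absBox (A₀ : ℝ) (A h δ : ι → ℝ) (hδ : ∀ i, |δ i| ≤ h i) :
    A₀ - ∑ i, |A i| * h i ≤ A₀ + ∑ i, A i * δ i := by
  have := linear_abs_le_absBox A h δ hδ
  have h2 := neg_abs_le (∑ i, A i * δ i)
  linarith

/-- An affine row holds on the whole cell iff the single rational check `∑ |A i| h i ≤ A₀`. -/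
theorem affine_nonneg_on_absBox {A₀ : ℝ} {A h : ι → ℝ} (hA : ∑ i, |A i| * h i ≤ A₀) (δ : ι → ℝ) (hδ : ∀ i, |δ i| ≤ h i) :
    0 ≤ A₀ + ∑ i, A i * δ i := by
  have := affine_ge_on_absBox A₀ A h δ hδ
  linarith

/-- The maximum modulus of a quadratic form over the box in closed form: `|δᵀ H δ| ≤ ∑∑ |H i j| h i h j`. -/
theorem quad_abs_le_absBox (H : ι → ι → ℝ) (h δ : ι → ℝ) (hδ : ∀ i, |δ i| ≤ h i) :
    |∑ i, ∑ j, H i j * δ i * δ j| ≤ ∑ i, ∑ j, |H i j| * h i * h j := by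
  refine (abs_sum_le_sum_abs _ _).trans (sum_le_sum fun i _ => ?_)
  refine (abs_sum_le_sum_abs _ _).trans (sum_le_sum fun j _ => ?_)
  rw [abs_mul, abs_mul]
  have hi := hδ i; have hj := hδ j
  have h0 : 0 ≤ h i := (abs_nonneg _).trans hi
  exact mul_le_mul (mul_le_mul_of_nonneg_left hi (abs_nonneg _)) hj (abs_nonneg _)
    (mul_nonneg (abs_nonneg _) h0)

/-- The two-variable instance the census uses most (cells in `(t, e)` or `(t, ρ)`): `|H₁₁ x² + 2 H₁₂ x y + H₂₂ y²| ≤ |H₁₁| h₁² + 2|H₁₂| h₁ h₂ + |H₂₂| h₂²`. -/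
theorem quad₂_abs_le_absBox (H₁₁ H₁₂ H₂₂ h₁ h₂ x y : ℝ) (hx : |x| ≤ h₁) (hy : |y| ≤ h₂) :
    |H₁₁ * x ^ 2 + 2 * H₁₂ * x * y + H₂₂ * y ^ 2| ≤ |H₁₁| * h₁ ^ 2 + 2 * |H₁₂| * h₁ * h₂ + |H₂₂| * h₂ ^ 2 := by
  have h0x : 0 ≤ h₁ := (abs_nonneg _).trans hx
  have h0y : 0 ≤ h₂ := (abs_nonneg _).trans hy
  have e1 : |H₁₁ * x ^ 2| ≤ |H₁₁| * h₁ ^ 2 := by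
    rw [abs_mul, abs_pow]; exact mul_le_mul_of_nonneg_left (pow_le_pow_left₀ (abs_nonneg _) hx 2) (abs_nonneg _)
  have e2 : |2 * H₁₂ * x * y| ≤ 2 * |H₁₂| * h₁ * h₂ := by
    rw [abs_mul, abs_mul, abs_mul, abs_two]
    have := mul_le_mul hx hy (abs_nonneg _) h0x
    nlinarith [abs_nonneg H₁₂]
  have e3 : |H₂₂ * y ^ 2| ≤ |H₂₂| * h₂ ^ 2 := by
    rw [abs_mul, abs_pow]; exact mul_le_mul_of_nonneg_left (pow_le_pow_left₀ (abs_nonneg _) hy 2) (abs_nonneg _)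
  calc |H₁₁ * x ^ 2 + 2 * H₁₂ * x * y + H₂₂ * y ^ 2| ≤ |H₁₁ * x ^ 2 + 2 * H₁₂ * x * y| + |H₂₂ * y ^ 2| := abs_add_le _ _
    _ ≤ |H₁₁ * x ^ 2| + |2 * H₁₂ * x * y| + |H₂₂ * y ^ 2| := by linarith [abs_add_le (H₁₁ * x ^ 2) (2 * H₁₂ * x * y)]
    _ ≤ _ := by linarith

end Summit.AtomisticToContinuum.Crystallization.Theorems.ChargedEnergyGapChartDial

end
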